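import Summits.QuantumFields.BalabanUV.T4Continuum.Support.NE3BlockMeanExactInterpolant
import HarnessLib

/-!
# T⁴ programme, node NE3 — census R32 (exact half, step 2b, file 1): THE SQUARED TENT PROFILE — `Π_i ((ρ_i∕M)(1 − ρ_i∕M))²` is `C¹`
# ACROSS THE BLOCK FACES: one step moves it by `≤ 2∕M`, it is `≤ 1∕M²` on a last slice, and its interior second differences are `≤ 3∕M²`

Cell `pub-balaban-gaps` (track G2, seat `ne3`; writer prover-pub-balaban-gaps-ne3-g6-0, 2026-08-23), census `run/shared/lean/pub/pub-balaban-gaps/ne/NE3.md`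
§4 R32.  WHY.  The competitor needed by `SlicB8LandauReduction` (p363714) must carry EXACT nested block means AND a flat Laplacian of size
`M^{d−4}·Σ|∇q|²`.  The tree's tent bump `NE3TentBump.bump M c = tent • c∘blk` restores block means but has a KINK at every block face (slope
`−1∕M → +1∕M`), so its second differences are `O(1∕M)`, one power short; SQUARING the profile removes the kink.  THIS FILE is the profile
calculus over the tree's `fac`∕`tent`∕`res`∕`blk` BY NAME: backward unit steps in block coordinates (`res_blk_sub_e_of_res_eq_zero`,
`res_blk_sub_e_of_res_ne_zero`, `res_sub_e_ne`), the squared factor (`abs_facSq_step_le`, **`abs_facSq_sdiff_le`**: for `p(t) = (t(1−t))²`,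
`p(t+h) − 2p(t) + p(t−h) = 2h²(1 − 6t(1−t)) + 2h⁴`, so `|·| ≤ 3h²`), and the squared tent (`abs_tentSq_step_le`, `tentSq_le_of_res_eq`,
`tent_eq_fac_mul`, `prod_erase_fac_step`, **`abs_tentSq_sdiff_le`** `|tent²(y+e_α) − 2tent²(y) + tent²(y−e_α)| ≤ 3∕M²` for `ρ_α ∉ {0, M−1}`).
File 2 (`NE3SquaredTentBump`) builds the bump `tent² • c∘blk` and its energies.

CONTENT ([folklore] lattice calculus; 0 sorry; no `def`).

HONEST FRAMING.  Pure lattice calculus; nothing about Bałaban's minimisers; (P♮) on `slicB8`, T-E_w and **NE3 are NOT proved** here; spine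
PROVED 0∕9; finite T⁴ rung (B)+1 — NOT continuum YM on ℝ⁴, NOT infinite volume, NOT mass gap, NOT Clay.
PLACEMENT: `Summits/QuantumFields/BalabanUV/T4Continuum/Support/`.
-/

set_option autoImplicit false

open scoped BigOperators
open Finset

namespace Summit.QuantumFields.BalabanUV.T4Continuum.NE3SquaredTentProfile

open Literature.MathematicalPhysics.QuantumFieldTheory.Balaban1983to89
open B7Prop1Explicit
open T4AveragingDeficitWallBoundary (periodBox mem_periodBox card_periodBox sum_periodBox_shift)
open SmoothRefineBlocks (blk res res_nonneg res_lt res_le blk_boxVec res_boxVec blk_res_smul blk_res_add_period blk_add_e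
  res_add_e_self res_add_e_ne)
open SmoothRefineInterp (wt wt_nonneg wt_le_one)
open NE3BlockLineAverage (sum_univ_boxVec sum_periodBox_blocks)
open NE3TangentNoGoWords (dPot)
open NE3CoarseInterpolant (blk_block)
open NE3TentBump (fac fac_nonneg fac_le_one wt_eq fac_le_inv_of_res_eq fac_eq_zero_of_res_eq_zero abs_fac_step_le tent tent_nonneg
  tent_le_one tent_eq_zero_of_res_eq_zero tent_le_inv_of_res_eq abs_tent_step_le tentSum tentSum_eq)

noncomputable section

variable {d : ℕ}

/-! ## §1 Backward steps in block coordinates, and the squared one-dimensional profile -/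

/-- A backward unit step from an ENTERING slice (`ρ_α = 0`) lands on the last slice of the previous block. [folklore] -/
theorem res_blk_sub_e_of_res_eq_zero {M : ℕ} (hM : 1 ≤ M) {y : Site d} {α : Fin d} (h : res M y α = 0) :
    res M (y - e α) α = (M : ℤ) - 1 ∧ blk M (y - e α) = blk M y - e α := by
  have hr := res_add_e_self hM (y - e α) α
  have hb := blk_add_e hM (y - e α) α
  rw [sub_add_cancel] at hr hb
  by_cases h' : res M (y - e α) α = (M : ℤ) - 1
  · rw [if_pos h'] at hb
    exact ⟨h', by rw [hb, add_sub_cancel_right]⟩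
  · rw [if_neg h'] at hr
    have := res_nonneg hM (y - e α) α
    omega

/-- A backward unit step from a NON-entering slice stays in the block and lowers the offset by one. [folklore] -/
theorem res_blk_sub_e_of_res_ne_zero {M : ℕ} (hM : 1 ≤ M) {y : Site d} {α : Fin d} (h : res M y α ≠ 0) :
    res M (y - e α) α = res M y α - 1 ∧ blk M (y - e α) = blk M y := by
  have hr := res_add_e_self hM (y - e α) α
  have hb := blk_add_e hM (y - e α) α
  rw [sub_add_cancel] at hr hb
  by_cases h' : res M (y - e α) α = (M : ℤ) - 1
  · rw [if_pos h'] at hr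
    exact absurd hr h
  · rw [if_neg h'] at hr
    rw [if_neg h', add_zero] at hb
    exact ⟨by omega, hb.symm⟩

/-- The offsets in the other directions are unchanged by a backward unit step. [folklore] -/
theorem res_sub_e_ne {M : ℕ} (hM : 1 ≤ M) (y : Site d) {μ ν : Fin d} (h : ν ≠ μ) : res M (y - e μ) ν = res M y ν := by
  have hr := res_add_e_ne hM (y - e μ) h
  rw [sub_add_cancel] at hr
  exact hr.symm

/-- One unit step INSIDE a block changes the squared factor of its own direction by at most `2∕M`. [folklore] -/
theorem abs_facSq_step_le {M : ℕ} (hM : 1 ≤ M) {y : Site d} {α : Fin d} (h : res M y α ≠ (M : ℤ) - 1) :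
    |fac M (y + e α) α ^ 2 - fac M y α ^ 2| ≤ 2 / (M : ℝ) := by
  have hfac : fac M (y + e α) α ^ 2 - fac M y α ^ 2 = (fac M (y + e α) α - fac M y α) * (fac M (y + e α) α + fac M y α) := by ring
  rw [hfac, abs_mul]
  have h1 := abs_fac_step_le hM h
  have h2 : |fac M (y + e α) α + fac M y α| ≤ 2 := by
    rw [abs_le]
    constructor <;> linarith [fac_nonneg hM (y + e α) α, fac_nonneg hM y α, fac_le_one hM (y + e α) α, fac_le_one hM y α]
  calc |fac M (y + e α) α - fac M y α| * |fac M (y + e α) α + fac M y α| ≤ (1 / (M : ℝ)) * 2 :=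
        mul_le_mul h1 h2 (abs_nonneg _) (by positivity)
    _ = 2 / M := by ring

/-- **THE INTERIOR SECOND DIFFERENCE OF THE SQUARED FACTOR**: away from both slices of a face (`ρ_α ∉ {0, M−1}`),
`|fac(y+e_α)² − 2·fac(y)² + fac(y−e_α)²| ≤ 3∕M²` — for `p(t) = (t(1−t))²`, `p(t+h) − 2p(t) + p(t−h) = 2h²(1 − 6t(1−t)) + 2h⁴`. [folklore] -/
theorem abs_facSq_sdiff_le {M : ℕ} (hM : 1 ≤ M) {y : Site d} {α : Fin d} (h1 : res M y α ≠ (M : ℤ) - 1) (h0 : res M y α ≠ 0) :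
    |fac M (y + e α) α ^ 2 - 2 * fac M y α ^ 2 + fac M (y - e α) α ^ 2| ≤ 3 / (M : ℝ) ^ 2 := by
  have hM0 : (0 : ℝ) < M := by exact_mod_cast (by omega : 0 < M)
  have hrn := res_nonneg hM y α
  have hrl := res_lt hM y α
  have hM2 : (2 : ℝ) ≤ M := by
    have : (2 : ℤ) ≤ (M : ℤ) := by omega
    exact_mod_cast this
  have hplus : wt M (y + e α) α = wt M y α + 1 / (M : ℝ) := by
    rw [wt_eq, wt_eq, res_add_e_self hM, if_neg h1]; push_cast; field_simp
  have hminus : wt M (y - e α) α = wt M y α - 1 / (M : ℝ) := by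
    rw [wt_eq, wt_eq, (res_blk_sub_e_of_res_ne_zero hM h0).1]; push_cast; field_simp
  set t := wt M y α with ht
  have ht0 : 0 ≤ t := wt_nonneg hM y α
  have ht1 : t ≤ 1 := wt_le_one hM y α
  unfold fac
  rw [hplus, hminus]
  have hid : ((t + 1 / (M : ℝ)) * (1 - (t + 1 / (M : ℝ)))) ^ 2 - 2 * (t * (1 - t)) ^ 2 + ((t - 1 / (M : ℝ)) * (1 - (t - 1 / (M : ℝ)))) ^ 2
      = 2 * (1 / (M : ℝ)) ^ 2 * (1 - 6 * (t * (1 - t))) + 2 * (1 / (M : ℝ)) ^ 4 := by ring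
  rw [hid]
  have hu0 : 0 ≤ t * (1 - t) := mul_nonneg ht0 (by linarith)
  have hu1 : t * (1 - t) ≤ 1 / 4 := by nlinarith [sq_nonneg (t - 1 / 2)]
  have hh0 : 0 ≤ (1 / (M : ℝ)) ^ 2 := by positivity
  have hh : (1 / (M : ℝ)) ^ 2 ≤ 1 / 4 := by
    rw [div_pow, one_pow, div_le_div_iff₀ (by positivity) (by norm_num)]
    nlinarith
  have hh4 : (1 / (M : ℝ)) ^ 4 = ((1 / (M : ℝ)) ^ 2) ^ 2 := by ring
  have h3 : 3 / (M : ℝ) ^ 2 = 3 * (1 / (M : ℝ)) ^ 2 := by rw [div_pow, one_pow]; ring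
  rw [hh4, h3, abs_le]
  constructor <;> nlinarith [mul_nonneg hh0 hh0, mul_le_mul_of_nonneg_left hh hh0]

/-! ## §2 The squared tent profile -/

/-- A unit step INSIDE a block changes `tent²` by at most `2∕M`. [folklore] -/
theorem abs_tentSq_step_le {M : ℕ} (hM : 1 ≤ M) {y : Site d} {α : Fin d} (h : res M y α ≠ (M : ℤ) - 1) :
    |tent M (y + e α) ^ 2 - tent M y ^ 2| ≤ 2 / (M : ℝ) := by
  have hfac : tent M (y + e α) ^ 2 - tent M y ^ 2 = (tent M (y + e α) - tent M y) * (tent M (y + e α) + tent M y) := by ring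
  rw [hfac, abs_mul]
  have h2 : |tent M (y + e α) + tent M y| ≤ 2 := by
    rw [abs_le]
    constructor <;> linarith [tent_nonneg hM (y + e α), tent_nonneg hM y, tent_le_one hM (y + e α), tent_le_one hM y]
  calc |tent M (y + e α) - tent M y| * |tent M (y + e α) + tent M y| ≤ (1 / (M : ℝ)) * 2 :=
        mul_le_mul (abs_tent_step_le hM h) h2 (abs_nonneg _) (by positivity)
    _ = 2 / M := by ring

/-- On a last slice `ρ_α = M − 1`, `tent² ≤ 1∕M²`. [folklore] -/
theorem tentSq_le_of_res_eq {M : ℕ} (hM : 1 ≤ M) {y : Site d} {α : Fin d} (h : res M y α = (M : ℤ) - 1) :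
    tent M y ^ 2 ≤ 1 / (M : ℝ) ^ 2 := by
  have h1 := tent_le_inv_of_res_eq hM h
  calc tent M y ^ 2 ≤ (1 / (M : ℝ)) ^ 2 := pow_le_pow_left₀ (tent_nonneg hM y) h1 2
    _ = 1 / (M : ℝ) ^ 2 := by rw [div_pow, one_pow]

/-- The tent factorises off its own-direction factor: `tent M y = fac M y α · Π_{i ≠ α} fac M y i`. [folklore] -/
theorem tent_eq_fac_mul (M : ℕ) (y : Site d) (α : Fin d) :
    tent M y = fac M y α * ∏ i ∈ Finset.univ.erase α, fac M y i := by
  unfold tent; rw [← Finset.mul_prod_erase _ _ (Finset.mem_univ α)]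

/-- The transverse factor `Π_{i ≠ α} fac M y i` is unchanged by a unit step along `α` (forward or backward). [folklore] -/
theorem prod_erase_fac_step (M : ℕ) (hM : 1 ≤ M) (y : Site d) (α : Fin d) :
    (∏ i ∈ Finset.univ.erase α, fac M (y + e α) i) = ∏ i ∈ Finset.univ.erase α, fac M y i ∧
      (∏ i ∈ Finset.univ.erase α, fac M (y - e α) i) = ∏ i ∈ Finset.univ.erase α, fac M y i := by
  constructor
  · refine Finset.prod_congr rfl fun i hi => ?_
    unfold fac; rw [wt_eq, wt_eq, res_add_e_ne hM y (Finset.ne_of_mem_erase hi)]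
  · refine Finset.prod_congr rfl fun i hi => ?_
    unfold fac; rw [wt_eq, wt_eq, res_sub_e_ne hM y (Finset.ne_of_mem_erase hi)]

/-- **THE INTERIOR SECOND DIFFERENCE OF `tent²` ALONG AN AXIS IS `≤ 3∕M²`** (`ρ_α ∉ {0, M − 1}`). [folklore] -/
theorem abs_tentSq_sdiff_le {M : ℕ} (hM : 1 ≤ M) {y : Site d} {α : Fin d} (h1 : res M y α ≠ (M : ℤ) - 1) (h0 : res M y α ≠ 0) :
    |tent M (y + e α) ^ 2 - 2 * tent M y ^ 2 + tent M (y - e α) ^ 2| ≤ 3 / (M : ℝ) ^ 2 := by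
  obtain ⟨hp, hm⟩ := prod_erase_fac_step M hM y α
  set R := ∏ i ∈ Finset.univ.erase α, fac M y i with hR
  have hR0 : 0 ≤ R := Finset.prod_nonneg fun i _ => fac_nonneg hM y i
  have hR1 : R ≤ 1 := Finset.prod_le_one (fun i _ => fac_nonneg hM y i) fun i _ => fac_le_one hM y i
  rw [tent_eq_fac_mul M (y + e α) α, tent_eq_fac_mul M y α, tent_eq_fac_mul M (y - e α) α, hp, hm]
  have hid : (fac M (y + e α) α * R) ^ 2 - 2 * (fac M y α * R) ^ 2 + (fac M (y - e α) α * R) ^ 2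
      = (fac M (y + e α) α ^ 2 - 2 * fac M y α ^ 2 + fac M (y - e α) α ^ 2) * R ^ 2 := by ring
  rw [hid, abs_mul, abs_of_nonneg (sq_nonneg R)]
  have hR2 : R ^ 2 ≤ 1 := pow_le_one₀ hR0 hR1
  calc |fac M (y + e α) α ^ 2 - 2 * fac M y α ^ 2 + fac M (y - e α) α ^ 2| * R ^ 2 ≤ 3 / (M : ℝ) ^ 2 * 1 :=
        mul_le_mul (abs_facSq_sdiff_le hM h1 h0) hR2 (sq_nonneg R) (by positivity)
    _ = 3 / (M : ℝ) ^ 2 := mul_one _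

end

end Summit.QuantumFields.BalabanUV.T4Continuum.NE3SquaredTentProfile
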